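import Literature.MathematicalPhysics.QuantumFieldTheory.Balaban1983to89.Beta.WilsonVertex2Sym
import Summits.QuantumFields.BalabanUV.Beta.D1BFx.ReducedTableBridge

/-!
# `BalabanUV.Beta.D1BFx.WilsonQuarticStencil` — road «BF-x» for binder row D1, leaf T5, sub-leaf T5-E₂:
# the WILSON-QUARTIC SECTOR of the BF second-order fine stencils in the road's `MKer 4 (Fin 4)` currency, with the
# sockets the road's consumers take (`ReducedTableF`, `ReducedTableBridge`, `ReducedKernelSandwich(Leg)`, `FineHessianWard/Reflection`)

HONEST FRAMING (cell contract, verbatim): «discharging `BetaPertH` makes Bałaban's UV stability UNCONDITIONAL — a real constructive-QFT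
result; it is NOT the continuum limit and NOT the Clay problem.»  THIS MODULE DISCHARGES NOTHING of the wall.  It types ONE sector (the
value 4-jet of the Wilson action, weight `cE₂` carried OUTSIDE) of ONE typer object (T5 `Wbf`, `HOME/b2b-balaban-beta-d1-p2/TYPER-SPEC-D1BFx.md`
§1; claim table `HOME/b2b-balaban-beta-d1-p2/LEAVES-BFx.md` row T5, sub-row T5-E₂, unit `b2b-balaban-beta-d1-formalise-leaf-09`) of ONE road
(BF-x) to ONE conjunct (D1) of `BetaPertH`, by RE-INDEXING an3's landed Wilson fine bi-stencil family
`WilsonBiStencil.wilsonW₂ 3 T κ u κ′ u′ : MKer 4 (Fib 3)` (field ⊕ multiplier fibre, zero off the field block) on the FIELD fibre `Fin 4` that the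
reduced road uses (`GluonLeg.Ga n a : MKer 4 (Fin 4)`, `ReducedKernel.TableR`), and transporting an3's certificates BY NAME.  0 wall binders
instantiated; NOT BetaPertH, NOT continuum, NOT Clay.  «not in print; our bookkeeping».
HONEST DEPENDENCY (verbatim): «continuum YM on T⁴ ⇐ BetaPertH ∧ nine spine estimates (0/9 proved); BetaPertH ⇐ (D1) ∧ (D4) ∧ CAP+tail;
G-an2-4 gates asym, D1 and NE2/3/4.»

ABSOLUTE RULE (cell, verbatim): «No internally-minted statement may enter as a cited fact. Every hypothesis is either kernel-proved in this
package or a verbatim quotation of a PUBLISHED theorem with page reference. The manuscript(s) under audit are NOT citable for their own disputed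
steps — they are the thing under adjudication; programme-internal (2001/route/tribunal) claims are never citable.»  Nothing is cited here; no
`def … : Prop`; one data `def` (`wq`, a re-indexing) and [folklore] lemmas about it, each an application of a landed theorem of an3
(`WilsonBiStencil`, `WilsonVertex2Sym`), of the typer (`ReducedTableF`) or of leaf-01 (`ReducedTableBridge`) BY NAME.

CONTENT (d = 3 throughout; `T : Fin 4 → Fin 4 → Fin 4 → Fin 4 → ℝ` a generic position table — the physical one is an3's colour-traced
`PlaquetteVertex2Trace.w22 N` resp. its symmetrisation `WilsonVertex2Sym.wsym22 N = symTab (w22 N)`, passed BY VALUE as in the wall family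
`BalabanStepW2.T2Of … 0 = cE₂ • wilsonW₂ d T + border`; the colour weight `cE₂` and the normalisation `symTab` vs `¼·symTab` are the
consumer's, CHECK-N0 — one `wq_smul` away).
* §1 [our object] `wq T κ u κ′ u′ : MKer 4 (Fin 4) := fun x z α β ↦ wEntry₂ 3 T κ u κ′ u′ x z α β` — the field–field block of `wilsonW₂ 3 T κ u κ′ u′`
  (`wq_eq_wilsonW₂_inl_inl`, `rfl`); uniform bound `|wq| ≤ wBound₂ 3 T`; CO-PLAQUETTE SUPPORT (`wq … = 0` unless `|u′ − u|₁ ≤ 2`; entries vanish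
  unless `|x − u|₁ ≤ 2 ∧ |z − u′|₁ ≤ 2`); linearity in `T`.
* §2 LOCALISATION for every rate `δ ≥ 0`: the TWO-CENTRE certificate `biLoc_wq_pair : BiLoc (wq T κ u κ′ u′) u u′ (wBound₂ 3 T·e^{4δ}) δ` — literally
  the binder `hW : ∀ κ′ u l′ u′, BiLoc (Wf κ′ u l′ u′) u u′ C2 δ` of `ReducedKernelSandwich.secondMoment_TOfRed_eq` / `ReducedTableF.vertexFamily₂_tableRedF` /
  `FineHessianWard.bondSecondMoment_TOfLeg_eq_avgM2_of_laws` — and the first-bond-centred `LocStencil₂` shape `biLoc_wq`.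
* §3 COVARIANCE: fine translation `wq T κ (u + v) κ′ (u′ + v) = shiftK (−v) (wq T κ u κ′ u′)` (= the binder `hWcov`), block form at any `n`.
* §4 SYMMETRY (an3's `WilsonVertex2Sym` §5 read on the field block): PAIR SWAP = background-slot swap `wq T κ′ u′ κ u = wq (swapKL T) κ u κ′ u′`,
  LEG TRANSPOSITION = fluctuation-slot swap; hence for a KL-symmetric table the binder `hWsymm : Wf κ′ u l′ u′ = Wf l′ u′ κ′ u` holds
  (`wq_symm_of_swapKL`), for an IJ-symmetric one the table is leg-symmetric; BOTH for `symTab T` and for the physical `wsym22 N` with no hypothesis.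
* §5 PLUGS at every blocking `n` (`[NeZero n]`): the ℋ⊗ℋ-dressed coarse table `tableRedF n (wq T)` is a `VertexFamily₂` (typer's
  `vertexFamily₂_tableRedF'`), block covariant (`tableRedF_translate`), equals leaf-01's iterated `tableRed n (wq T)` (`tableRedF_eq_tableRed`), and the
  same two sockets for `tableRed n (wq T)`.
NOT IN THIS FILE (open sub-leaves of row T5, said so that nobody reads more into it): the J4 weight vertex and the second jets of J3/J5/J6 (the
other sectors of `Wbf`); the second-order WARD law (W2) `divW wq u λ′ u′ = X u ∘ S λ′ u′ − S λ′ u′ ∘ X u` and the AXIS-REFLECTION law of `wq`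
consumed by leaf-01's `…_of_laws` ENDs (an3's word-level `WilsonWardJets2.ward12` / `WilsonWard22.ward22` and the first-order stencil laws
`WilsonStencilReflection` / `WilsonDivergenceContact` are in the tree; the stencil-level second-order transcriptions are separate sub-leaves).
Nothing about `KInv`, `BetaPertH`, `D1Drift`, any β-coefficient value.
-/

noncomputable section

namespace Summit.QuantumFields.BalabanUV.Beta.D1BFx.WilsonQuarticStencil

open Finset
open scoped BigOperators
open Literature.MathematicalPhysics.QuantumFieldTheory.Balaban1983to89
open Literature.MathematicalPhysics.QuantumFieldTheory.Balaban1983to89.Beta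
open B12Sec2to5 (l1 l1_nonneg)
open ExpKernelCalculus (Site MKer BiLoc VertexFamily₂ shiftK)
open OneStepResolventKernel (Fib)
open PlaquetteVertex2Trace (w22)
open WilsonBiStencil (wEntry₂ wilsonW₂ wBound₂ wBound₂_nonneg abs_wEntry₂_le wEntry₂_eq_zero_or wEntry₂_eq_zero_of_two_lt
  abs_wEntry₂_le_exp abs_wEntry₂_le_exp_pair wEntry₂_translate wEntry₂_add wEntry₂_smul)
open WilsonVertex2Sym (swapIJ swapKL symTab swapIJ_symTab swapKL_symTab wsym22 symTab_w22 wEntry₂_swap wEntry₂_transpose)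
open Summit.QuantumFields.BalabanUV.Beta.D1BFx.ReducedTableF (tableRedF vertexFamily₂_tableRedF' tableRedF_translate)
open Summit.QuantumFields.BalabanUV.Beta.D1BFx.DressedTadpoleTable (tableRed)
open Summit.QuantumFields.BalabanUV.Beta.D1BFx.ReducedTableBridge (tableRedF_eq_tableRed vertexFamily₂_tableRed' tableRed_translate_of_fine)

/-! ## §1 The object: the field block of an3's Wilson fine bi-stencil, on the field fibre `Fin 4` -/

section Object

/-- [our object] **THE WILSON-QUARTIC FINE SECOND-ORDER TABLE OF ROAD BF-x** (d = 3): per ordered pair of fine bonds `(κ, u)`, `(κ′, u′)` (the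
two BACKGROUND legs) the kernel on the FIELD fibre `Fin 4` in the two fluctuation legs — the field–field block of an3's
`WilsonBiStencil.wilsonW₂ 3 T κ u κ′ u′` (which is zero on every block touching a multiplier leg), i.e. `WilsonBiStencil.wEntry₂ 3 T`.  Generic in
the position table `T`; a re-indexing asserting nothing. -/
def wq (T : Fin 4 → Fin 4 → Fin 4 → Fin 4 → ℝ) (κ : Fin 4) (u : Site 4) (κ' : Fin 4) (u' : Site 4) : MKer 4 (Fin 4) :=
  fun x z α β => wEntry₂ 3 T κ u κ' u' x z α β

variable (T T' : Fin 4 → Fin 4 → Fin 4 → Fin 4 → ℝ)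

/-- [our object] Unfolding of `wq`. -/
theorem wq_apply (κ : Fin 4) (u : Site 4) (κ' : Fin 4) (u' : Site 4) (x z : Site 4) (α β : Fin 4) :
    wq T κ u κ' u' x z α β = wEntry₂ 3 T κ u κ' u' x z α β := rfl

/-- [our object] `wq` IS the field–field block of an3's `wilsonW₂ 3 T` (by `rfl`, `WilsonBiStencil.wilsonW₂_inl_inl`). -/
theorem wq_eq_wilsonW₂_inl_inl (κ : Fin 4) (u : Site 4) (κ' : Fin 4) (u' : Site 4) (x z : Site 4) (α β : Fin 4) :
    wq T κ u κ' u' x z α β = wilsonW₂ 3 T κ u κ' u' x z (Sum.inl α) (Sum.inl β) := rfl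

/-- [folklore] Every entry is bounded by an3's uniform constant `wBound₂ 3 T = 16 · tabSum T` (`abs_wEntry₂_le`). -/
theorem abs_wq_le (κ : Fin 4) (u : Site 4) (κ' : Fin 4) (u' : Site 4) (x z : Site 4) (α β : Fin 4) :
    |wq T κ u κ' u' x z α β| ≤ wBound₂ 3 T :=
  abs_wEntry₂_le T κ u κ' u' x z α β

/-- [folklore] FINITE RANGE AND CO-PLAQUETTE SUPPORT: an entry vanishes unless the row site lies within `ℓ¹`-distance 2 of the first bond, the
column site within 2 of the second bond, and the two bonds within 2 of each other (`wEntry₂_eq_zero_or`). -/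
theorem wq_apply_eq_zero_or (κ : Fin 4) (u : Site 4) (κ' : Fin 4) (u' : Site 4) (x z : Site 4) (α β : Fin 4) :
    wq T κ u κ' u' x z α β = 0 ∨ (l1 (x - u) ≤ 2 ∧ l1 (z - u') ≤ 2 ∧ l1 (u' - u) ≤ 2) :=
  wEntry₂_eq_zero_or T κ u κ' u' x z α β

/-- [folklore] **THE TABLE IS SUPPORTED ON CO-PLAQUETTE BOND PAIRS**: `wq T κ u κ′ u′ = 0` unless `|u′ − u|₁ ≤ 2`. -/
theorem wq_eq_zero_of_two_lt {κ : Fin 4} {u : Site 4} {κ' : Fin 4} {u' : Site 4} (h : 2 < l1 (u' - u)) :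
    wq T κ u κ' u' = 0 := by
  funext x z α β
  exact wEntry₂_eq_zero_of_two_lt T h x z α β

/-- [folklore] The table is ADDITIVE in the position table (weighted word sums are assembled from per-word tables). -/
theorem wq_add (κ : Fin 4) (u : Site 4) (κ' : Fin 4) (u' : Site 4) :
    wq (T + T') κ u κ' u' = wq T κ u κ' u' + wq T' κ u κ' u' := by
  funext x z α β
  exact wEntry₂_add T T' κ u κ' u' x z α β

/-- [folklore] The table is HOMOGENEOUS in the position table (the colour weight `cE₂` and the `¼` of a Taylor normalisation go here). -/
theorem wq_smul (r : ℝ) (κ : Fin 4) (u : Site 4) (κ' : Fin 4) (u' : Site 4) :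
    wq (r • T) κ u κ' u' = r • wq T κ u κ' u' := by
  funext x z α β
  exact wEntry₂_smul T r κ u κ' u' x z α β

end Object

/-! ## §2 Localisation certificates (every rate `δ ≥ 0`; finite range pays `e^{4δ}` / `e^{8δ}`) -/

section Loc

variable (T : Fin 4 → Fin 4 → Fin 4 → Fin 4 → ℝ)

/-- [folklore] **THE TWO-CENTRE CERTIFICATE** (row leg at the first bond, column leg at the second — the road's `hW` binder shape and the
`VertexFamily₂` shape), for every `δ ≥ 0`: `BiLoc (wq T κ u κ′ u′) u u′ (wBound₂ 3 T · e^{4δ}) δ` (`abs_wEntry₂_le_exp_pair` BY NAME). -/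
theorem biLoc_wq_pair {δ : ℝ} (hδ : 0 ≤ δ) (κ : Fin 4) (u : Site 4) (κ' : Fin 4) (u' : Site 4) :
    BiLoc (wq T κ u κ' u') u u' (wBound₂ 3 T * Real.exp (4 * δ)) δ :=
  fun x z α β => abs_wEntry₂_le_exp_pair T hδ κ u κ' u' x z α β

/-- [folklore] The two-centre certificate quantified over all bond pairs — LITERALLY the binder
`hW : ∀ κ′ u l′ u′, BiLoc (Wf κ′ u l′ u′) u u′ C2 δ` of the road's ENDs at `Wf := wq T`, `C2 := wBound₂ 3 T · e^{4δ}`, any `δ ≥ 0`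
(take `δ = 1` where `0 < δ` is asked). -/
theorem biLoc_wq_pair_all {δ : ℝ} (hδ : 0 ≤ δ) :
    ∀ (κ : Fin 4) (u : Site 4) (κ' : Fin 4) (u' : Site 4), BiLoc (wq T κ u κ' u') u u' (wBound₂ 3 T * Real.exp (4 * δ)) δ :=
  fun κ u κ' u' => biLoc_wq_pair T hδ κ u κ' u'

/-- [folklore] **THE FIRST-BOND-CENTRED CERTIFICATE WITH A CONSTANT DECAYING IN THE BOND SEPARATION** (the `LocStencil₂` shape), every
`δ ≥ 0`: `BiLoc (wq T κ u κ′ u′) u u (wBound₂ 3 T · e^{8δ} · e^{−δ|u′ − u|₁}) δ` (`abs_wEntry₂_le_exp` BY NAME). -/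
theorem biLoc_wq {δ : ℝ} (hδ : 0 ≤ δ) (κ : Fin 4) (u : Site 4) (κ' : Fin 4) (u' : Site 4) :
    BiLoc (wq T κ u κ' u') u u (wBound₂ 3 T * Real.exp (8 * δ) * Real.exp (-δ * l1 (u' - u))) δ :=
  fun x z α β => abs_wEntry₂_le_exp T hδ κ u κ' u' x z α β

end Loc

/-! ## §3 Covariance -/

section Cov

variable (T : Fin 4 → Fin 4 → Fin 4 → Fin 4 → ℝ)

/-- [folklore] **FINE-TRANSLATION COVARIANCE**: translating both bonds by `v` shifts the kernel,
`wq T κ (u + v) κ′ (u′ + v) = shiftK (−v) (wq T κ u κ′ u′)` — literally the binder `hWcov` of `ReducedKernelSandwich.secondMoment_TOfRed_eq` /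
`ReducedTableBridge.TOfLeg_tableRedF_eq_dressedEntryP` (`wEntry₂_translate` BY NAME). -/
theorem wq_translate (κ : Fin 4) (u : Site 4) (κ' : Fin 4) (u' v : Site 4) :
    wq T κ (u + v) κ' (u' + v) = shiftK (-v) (wq T κ u κ' u') := by
  funext x z α β
  show wEntry₂ 3 T κ (u + v) κ' (u' + v) x z α β = wEntry₂ 3 T κ u κ' u' (x + -v) (z + -v) α β
  rw [wEntry₂_translate, ← sub_eq_add_neg, ← sub_eq_add_neg]

/-- [folklore] BLOCK form at any blocking `n` (the binder of `ReducedTableF.tableRedF_translate` / `FineHessianWard.…_of_laws`):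
`wq T κ (u + n•t) κ′ (u′ + n•t) = shiftK (−n•t) (wq T κ u κ′ u′)`. -/
theorem wq_translate_block (n : ℕ) (κ : Fin 4) (u : Site 4) (κ' : Fin 4) (u' t : Site 4) :
    wq T κ (u + (n : ℤ) • t) κ' (u' + (n : ℤ) • t) = shiftK (-((n : ℤ) • t)) (wq T κ u κ' u') :=
  wq_translate T κ u κ' u' ((n : ℤ) • t)

end Cov

/-! ## §4 Symmetry: pair swap and leg transposition are slot swaps of the table -/

section Symm

variable (T : Fin 4 → Fin 4 → Fin 4 → Fin 4 → ℝ)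

/-- [folklore] **PAIR SWAP = BACKGROUND-SLOT SWAP OF THE TABLE**: `wq T κ′ u′ κ u = wq (swapKL T) κ u κ′ u′` (an3's `wEntry₂_swap`). -/
theorem wq_swap (κ : Fin 4) (u : Site 4) (κ' : Fin 4) (u' : Site 4) :
    wq T κ' u' κ u = wq (swapKL T) κ u κ' u' := by
  funext x z α β
  exact wEntry₂_swap T κ u κ' u' x z α β

/-- [folklore] **LEG TRANSPOSITION = FLUCTUATION-SLOT SWAP OF THE TABLE**: `wq T κ u κ′ u′ z x β α = wq (swapIJ T) κ u κ′ u′ x z α β`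
(an3's `wEntry₂_transpose`). -/
theorem wq_transpose (κ : Fin 4) (u : Site 4) (κ' : Fin 4) (u' : Site 4) (x z : Site 4) (α β : Fin 4) :
    wq T κ u κ' u' z x β α = wq (swapIJ T) κ u κ' u' x z α β :=
  wEntry₂_transpose T κ u κ' u' x z α β

/-- [folklore] **PAIR SYMMETRY FOR A KL-SYMMETRIC TABLE** — literally the binder `hWsymm : ∀ κ′ u l′ u′, Wf κ′ u l′ u′ = Wf l′ u′ κ′ u` of
`ReducedKernelSandwich.secondMoment_TOfRed_eq` / `FineHessianWard.hasSum_row_fineHessA_of_wardLaws` at `Wf := wq T`. -/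
theorem wq_symm_of_swapKL (hT : swapKL T = T) :
    ∀ (κ : Fin 4) (u : Site 4) (κ' : Fin 4) (u' : Site 4), wq T κ u κ' u' = wq T κ' u' κ u := by
  intro κ u κ' u'
  rw [wq_swap T κ' u' κ u, hT]

/-- [folklore] LEG SYMMETRY FOR AN IJ-SYMMETRIC TABLE: `wq T κ u κ′ u′ z x β α = wq T κ u κ′ u′ x z α β`. -/
theorem wq_transpose_of_swapIJ (hT : swapIJ T = T) (κ : Fin 4) (u : Site 4) (κ' : Fin 4) (u' : Site 4) (x z : Site 4)
    (α β : Fin 4) : wq T κ u κ' u' z x β α = wq T κ u κ' u' x z α β := by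
  rw [wq_transpose T κ u κ' u' x z α β, hT]

/-- [folklore] **THE SYMMETRISED TABLE IS PAIR-SYMMETRIC** with no hypothesis (`swapKL (symTab T) = symTab T`). -/
theorem wq_symTab_symm :
    ∀ (κ : Fin 4) (u : Site 4) (κ' : Fin 4) (u' : Site 4), wq (symTab T) κ u κ' u' = wq (symTab T) κ' u' κ u :=
  wq_symm_of_swapKL (symTab T) (swapKL_symTab T)

/-- [folklore] **THE SYMMETRISED TABLE IS LEG-SYMMETRIC** with no hypothesis (`swapIJ (symTab T) = symTab T`). -/
theorem wq_symTab_transpose (κ : Fin 4) (u : Site 4) (κ' : Fin 4) (u' : Site 4) (x z : Site 4) (α β : Fin 4) :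
    wq (symTab T) κ u κ' u' z x β α = wq (symTab T) κ u κ' u' x z α β :=
  wq_transpose_of_swapIJ (symTab T) (swapIJ_symTab T) κ u κ' u' x z α β

/-- [folklore] THE SYMMETRISED TABLE IS THE FOUR-TERM SYMMETRISATION of the ordered one, entrywise:
`wq (symTab T) κ u κ′ u′ x z α β = wq T κ u κ′ u′ x z α β + wq T κ u κ′ u′ z x β α + wq T κ′ u′ κ u x z α β + wq T κ′ u′ κ u z x β α`
(the mixed fourth derivative; whether the consumer's slot takes `symTab` or `¼·symTab` is one `wq_smul` away — not decided here). -/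
theorem wq_symTab_apply (κ : Fin 4) (u : Site 4) (κ' : Fin 4) (u' : Site 4) (x z : Site 4) (α β : Fin 4) :
    wq (symTab T) κ u κ' u' x z α β
      = wq T κ u κ' u' x z α β + wq T κ u κ' u' z x β α + wq T κ' u' κ u x z α β + wq T κ' u' κ u z x β α := by
  simp only [wq_apply]
  rw [WilsonVertex2Sym.symTab_eq_add, wEntry₂_add, wEntry₂_add, wEntry₂_add,
    wEntry₂_transpose T κ u κ' u' x z α β, wEntry₂_swap T κ u κ' u' x z α β,
    wEntry₂_transpose T κ' u' κ u x z α β, wEntry₂_swap (swapIJ T) κ u κ' u' x z α β,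
    WilsonVertex2Sym.swapIJ_swapKL]

/-- [folklore] **THE PHYSICAL INSTANCE**: for an3's colour-traced Wilson table the symmetrised road table IS the road table of the closed-form
symmetrised table `wsym22 N` (`WilsonVertex2Sym.symTab_w22`), hence `wq (wsym22 N)` is pair- and leg-symmetric with no hypothesis. -/
theorem wq_symTab_w22 (N : ℕ) : wq (symTab (w22 N)) = wq (wsym22 N) := by
  rw [symTab_w22]

/-- [folklore] `wq (wsym22 N)` satisfies the road's `hWsymm` binder. -/
theorem wq_wsym22_symm (N : ℕ) :
    ∀ (κ : Fin 4) (u : Site 4) (κ' : Fin 4) (u' : Site 4), wq (wsym22 N) κ u κ' u' = wq (wsym22 N) κ' u' κ u := by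
  rw [← wq_symTab_w22]
  exact wq_symTab_symm (w22 N)

/-- [folklore] `wq (wsym22 N)` is leg-symmetric. -/
theorem wq_wsym22_transpose (N : ℕ) (κ : Fin 4) (u : Site 4) (κ' : Fin 4) (u' : Site 4) (x z : Site 4) (α β : Fin 4) :
    wq (wsym22 N) κ u κ' u' z x β α = wq (wsym22 N) κ u κ' u' x z α β := by
  rw [← wq_symTab_w22]
  exact wq_symTab_transpose (w22 N) κ u κ' u' x z α β

end Symm

/-! ## §5 Plugs: the ℋ⊗ℋ-dressed coarse Wilson-quartic table at every blocking `n` -/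

section Plugs

variable (T : Fin 4 → Fin 4 → Fin 4 → Fin 4 → ℝ) (n : ℕ) [NeZero n]

/-- [folklore] **THE DRESSED COARSE WILSON-QUARTIC TABLE IS A SECOND-ORDER VERTEX FAMILY AT EVERY BLOCKING** (the `hW` input of
`ReducedKernelF.absMoment₂_TOfLeg` / `ReducedKernel.absMoment₂_TOfRed`): `∃ Cw2 δ2, 0 < δ2 ∧ δ2 ≤ 1 ∧ VertexFamily₂ (tableRedF n (wq T)) n Cw2 δ2`
— the typer's `vertexFamily₂_tableRedF'` on `biLoc_wq_pair` at rate `1`. -/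
theorem vertexFamily₂_tableRedF_wq : ∃ Cw2 δ2 : ℝ, 0 < δ2 ∧ δ2 ≤ 1 ∧ VertexFamily₂ (tableRedF n (wq T)) n Cw2 δ2 :=
  vertexFamily₂_tableRedF' n (biLoc_wq_pair_all T zero_le_one) one_pos

/-- [folklore] **BLOCK COVARIANCE OF THE DRESSED COARSE WILSON-QUARTIC TABLE** (the `hW`-covariance input of `ReducedKernelF.blockCovariant_TOfLeg`):
`tableRedF n (wq T) μ (y + t) ν (y′ + t) = shiftK (−n•t) (tableRedF n (wq T) μ y ν y′)` — the typer's `tableRedF_translate` on `wq_translate_block`. -/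
theorem tableRedF_wq_translate (μ : Fin 4) (y : Site 4) (ν : Fin 4) (y' t : Site 4) :
    tableRedF n (wq T) μ (y + t) ν (y' + t) = shiftK (-((n : ℤ) • t)) (tableRedF n (wq T) μ y ν y') :=
  tableRedF_translate n (fun κ' u l' u' t' => wq_translate_block T n κ' u l' u' t') μ y ν y' t

/-- [folklore] **THE TYPER'S AND LEAF-01's DRESSINGS AGREE ON THE WILSON-QUARTIC TABLE**: `tableRedF n (wq T) = tableRed n (wq T)`
(leaf-01's bridge `tableRedF_eq_tableRed` on `biLoc_wq_pair` at rate `1`; one `Σ_{λ′}` ↔ `Σ′_u` exchange, not `rfl`). -/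
theorem tableRedF_wq_eq_tableRed : tableRedF n (wq T) = tableRed n (wq T) :=
  tableRedF_eq_tableRed n (biLoc_wq_pair_all T zero_le_one) one_pos

/-- [folklore] The iterated dressing `tableRed n (wq T)` is a second-order vertex family at every blocking (through the bridge). -/
theorem vertexFamily₂_tableRed_wq : ∃ Cw2 δ2 : ℝ, 0 < δ2 ∧ δ2 ≤ 1 ∧ VertexFamily₂ (tableRed n (wq T)) n Cw2 δ2 :=
  vertexFamily₂_tableRed' n (biLoc_wq_pair_all T zero_le_one) one_pos

/-- [folklore] Block covariance of the iterated dressing `tableRed n (wq T)` (through the bridge, from FINE covariance). -/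
theorem tableRed_wq_translate (μ : Fin 4) (y : Site 4) (ν : Fin 4) (y' t : Site 4) :
    tableRed n (wq T) μ (y + t) ν (y' + t) = shiftK (-((n : ℤ) • t)) (tableRed n (wq T) μ y ν y') :=
  tableRed_translate_of_fine n (biLoc_wq_pair_all T zero_le_one) one_pos (fun κ' u l' u' v => wq_translate T κ' u l' u' v) μ y ν y' t

end Plugs

end Summit.QuantumFields.BalabanUV.Beta.D1BFx.WilsonQuarticStencil

end
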